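import Summits.CriticalPhenomena.Ising3DConformalLimit.Theorems.ReflectionTwinExistsContinuousLimitWeightedIffExponent
import Summits.CriticalPhenomena.Ising3DConformalLimit.Theorems.MoebiusLimitExists.Negative.PinnedClusterPoints
import Summits.CriticalPhenomena.Ising3DConformalLimit.Theorems.HyperoctahedralRPLimitRotationInvariant
import Summits.CriticalPhenomena.Ising3DConformalLimit.Theorems.HyperoctahedralRPHRP2Rigidity
import HarnessLib

/-!
# The open stub K1′ of line `Sketch` follows from the crux together with item 1982 — it is route-consistent
# (crux `ExistsContinuousLimit`, stmt-CriticalPhenomena-4582; registered sub-goal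
# `clusterPointInversionCovariant_of_crux_of_inversionUpgrade`)

K1′ = `stub_clusterPointInversionCovariant` (OPEN): every normalised cluster point of the pinned `ℤ³` zoom is covariant
under the unit inversion with SOME continuous positive weight. It is NOT implied by the crux alone (existence + scale
covariance give no inversion), but it IS implied by the crux together with this route's inversion-upgrade crux item 1982
`ReflectionTwin.InversionUpgradeNormalised`: given a crux witness `(ρ, Δ, S')`, rotation invariance of `S'` is a THEOREM
(items 1979 `HRP2Rigidity_of` ∧ 1980 `LimitRotationInvariant_of`), so item 1982 makes `S'` inversion covariant with
exponent `Δ`; every cluster point `S` of the pinned zoom is `aⁿ S'ₙ` off the diagonals (`clusterPoint_eq`, `a > 0`), the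
unit inversion preserves non-coincidence, and normalisation handles the diagonals — so `S` is inversion covariant with
the weight `‖·‖^{2Δ}`. Consequently a refutation of K1′ would refute `crux ∧ item 1982`, i.e. the route, and the line's
`C⁺ = 6150 ∧ K1′ ∧ TD` sits between the crux and `crux ∧ 1982`. [folklore]
-/

noncomputable section

namespace Summit.CriticalPhenomena.Ising3DConformalLimit.ReflectionTwinExistsContinuousLimit

open Literature.Probability.LatticeModels Filter Set EuclideanGeometry
open scoped Topology
open Summit.CriticalPhenomena.Ising3DConformalLimit.MoebiusLimitExistsOnlyInteraction (IsClusterPoint)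
open Summit.CriticalPhenomena.Ising3DConformalLimit.PinnedClusterPoints (clusterPoint_eq)
open Summit.CriticalPhenomena.Ising3DConformalLimit.Theses
open Summit.CriticalPhenomena.Ising3DConformalLimit.Cruxes.LimitRotationInvariant.QuarterTurnLiouville
  (LimitRotationInvariant_of)
open Summit.CriticalPhenomena.Ising3DConformalLimit.Cruxes.HRP2Rigidity.XRayMellin (HRP2Rigidity_of)

/-- **Inversion covariance of the limit passes to every normalised cluster point of the pinned zoom** (a cluster point
is `aⁿ S'ₙ` off the diagonals, the unit inversion preserves non-coincidence, normalisation handles the rest). [folklore] -/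
theorem clusterPoint_inversionCovariant_of_limit {ρ : ℝ → ℝ} {Δ : ℝ} {S' S : CorrFamily 3}
    (hρ : ∀ δ ∈ Set.Ioc (0:ℝ) 1, 0 < ρ δ) (hlim : HasPointwiseScalingLimit (criticalCorr 3) ρ S')
    (hnd : IsNondegenerateTwoPoint S') (hinv : IsInversionCovariant Δ S')
    (hN : ∀ n z, z ∉ NonCoincident 3 n → S n z = 0) (hS : IsClusterPoint S) : IsInversionCovariant Δ S := by
  intro n x hx
  by_cases hxN : x ∈ NonCoincident 3 n
  · have hιN : (fun i => inversion (0 : EuclideanSpace ℝ (Fin 3)) 1 (x i)) ∈ NonCoincident 3 n := by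
      rw [mem_nonCoincident] at hxN ⊢
      exact (inversion_injective (0 : EuclideanSpace ℝ (Fin 3)) one_ne_zero).comp hxN
    rw [clusterPoint_eq hρ hlim hnd hS hιN, clusterPoint_eq hρ hlim hnd hS hxN, hinv n x hx]
    ring
  · have hιN : (fun i => inversion (0 : EuclideanSpace ℝ (Fin 3)) 1 (x i)) ∉ NonCoincident 3 n := by
      intro h
      apply hxN
      rw [mem_nonCoincident] at h ⊢
      intro i j hij
      exact h (by simp [hij])
    rw [hN n _ hιN, hN n x hxN, mul_zero]

/-- **Registered sub-goal `clusterPointInversionCovariant_of_crux_of_inversionUpgrade`: the crux ∧ item 1982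
`InversionUpgradeNormalised` ⟹ K1′** (rotation invariance of the crux witness is the proved items 1979 ∧ 1980; the
weight is `‖·‖^{2Δ}`). [folklore] -/
theorem clusterPointInversionCovariant_of_crux_of_inversionUpgrade :
    Summit.CriticalPhenomena.Ising3DConformalLimit.Theses.ReflectionTwin.ExistsContinuousLimit →
    Summit.CriticalPhenomena.Ising3DConformalLimit.Theses.ReflectionTwin.InversionUpgradeNormalised →
    ∀ S : Literature.Probability.LatticeModels.CorrFamily 3,
      (∀ n z, z ∉ Literature.Probability.LatticeModels.NonCoincident 3 n → S n z = 0) →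
      Summit.CriticalPhenomena.Ising3DConformalLimit.MoebiusLimitExistsOnlyInteraction.IsClusterPoint S →
      ∃ w : EuclideanSpace ℝ (Fin 3) → ℝ, (∀ v, v ≠ 0 → 0 < w v) ∧ ContinuousOn w {0}ᶜ ∧
        ∀ (n : ℕ) (x : Fin n → EuclideanSpace ℝ (Fin 3)), (∀ i, x i ≠ 0) →
          S n (fun i => EuclideanGeometry.inversion (0 : EuclideanSpace ℝ (Fin 3)) 1 (x i)) =
            (∏ i, w (x i)) * S n x := by
  rintro ⟨ρ, Δ, S', hρ, _hΔ, hlim, hnorm, _hcont, hnd, htr, hsc⟩ hI S hN hS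
  have hrot : IsRotationInvariant S' := LimitRotationInvariant_of HRP2Rigidity_of ρ Δ S' hρ hlim hnorm hnd htr hsc
  have hinv' : IsInversionCovariant Δ S' := hI ρ Δ S' hρ hlim hnorm hnd ⟨htr, hrot⟩ hsc
  have hinv : IsInversionCovariant Δ S := clusterPoint_inversionCovariant_of_limit hρ hlim hnd hinv' hN hS
  exact ⟨fun v => ‖v‖ ^ (2 * Δ), norm_rpow_weight_pos Δ, norm_rpow_weight_continuousOn Δ,
    fun n x hx => hinv n x hx⟩

end Summit.CriticalPhenomena.Ising3DConformalLimit.ReflectionTwinExistsContinuousLimit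

end
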